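import Summits.CriticalPhenomena.PercolationContinuityZ3.Theorems.Transplant.SkelFrmFromBChoiceZone
import Summits.CriticalPhenomena.PercolationContinuityZ3.Theorems.Transplant.SkelFrmQuasiBChoiceZoneKPx
import Summits.CriticalPhenomena.PercolationContinuityZ3.Theorems.Transplant.PlanarSkeletonFrmQuasiDefs
import Summits.CriticalPhenomena.PercolationContinuityZ3.Theorems.Transplant.PlanarSkeletonFrmQuasiProx
import Summits.CriticalPhenomena.PercolationContinuityZ3.Theorems.Transplant.PlanarSkeletonFrmQuasiProxies
import Summits.CriticalPhenomena.PercolationContinuityZ3.Theorems.Transplant.SkelFrmQuasi1ChoiceDefs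
import Summits.CriticalPhenomena.PercolationContinuityZ3.Theorems.Transplant.SkelFrmQuasi1SlotTypes
import Summits.CriticalPhenomena.PercolationContinuityZ3.Theorems.Transplant.SkelFrmQuasiBChoiceDefs
import Summits.CriticalPhenomena.PercolationContinuityZ3.Theorems.Transplant.SkelFrmQuasiBChoiceDefs3
import Summits.CriticalPhenomena.PercolationContinuityZ3.Theorems.Transplant.SkelFrmQuasi1SlotTypes
import HarnessLib

/-!
# GEN-Q PORT (WAVE-Q table v0.8 section 2, row G273, U-level L?; captain R-6/R-7 2026-08-27: carrier token swap `PlanarSkeletonFrmFrom ↦ PlanarSkeletonFrmQuasi`)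
# of the tree module «Transplant/SkelFrmFromBChoiceZonePx» (sha256 d83191d2cfdd8be8…) onto the quasi-step carrier `PlanarSkeletonFrmQuasi` (p507026): «SkelFrmQuasiBChoiceZonePx»

ORIGINAL TITLE: 

builds on p205010 (kernel theorem, internal audit signed; external expert review pending) — nothing in this file uses p205010; NOTHING is claimed about any open node
((N3-b), the end state).  Lane `prim-bschramm`, seat `prim-bschramm-gen-1` (gen 5; WAVE-Q captain).  Helper file (`--supports stmt-CriticalPhenomena-4575 --as helper`).
PORT RULES (U-wave r1–r4 re-used, GEN-Q hunk classes of p3-g29 #6136): declaration order, names and proof texts are those of «SkelFrmFromBChoiceZonePx», byte-identical except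
(i) the carrier token `PlanarSkeletonFrmFrom ↦ PlanarSkeletonFrmQuasi` in binders, `namespace`/`end` lines and qualified names (module names `SkelFrmFrom… ↦ SkelFrmQuasi…`
in imports of already-ported rows); (ii) `Φ.step ↦ Φ.qstep` with the called Steps lemma replaced by its `…Q`/`_q` twin and the cost `Φ.M` threaded (none in this file unless
listed below); (iii) `Φ.cyl_connected ↦ Φ.cyl_reach` readers (none unless listed); (iv) graph-ball radii / window floors ×`Φ.M` (none unless listed); r2 (U-wave rule, tool T8 = p3-g30's inline_r2.py): the section `variable` binders that bind the carrier are inlined into 5 kept header(s) (the gate's dedup otherwise reads a carrier-free header as a restatement of the FrmFrom twin).  Carrier-free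
residents stay imported/exported from the original «SkelFrmBChoiceZonePx» exactly as in the FrmFrom port.  Docstrings and citations are the original's.
Row G273 (gen-1 g5).
-/

noncomputable section

open scoped Classical

namespace Summit.CriticalPhenomena.PercolationContinuityZ3.Theorems.Transplant

open MeasureTheory Literature.Probability.Percolation Literature.Probability.LatticeModels SimpleGraph KNCells KNLevels
open Literature.Barriers.CriticalPhenomena (graphBall graphBall_mono)
open SkelConc (Consts)
open Skelφ (oriφ trφ)
open Skelφ.StepI (DataN DataNS OutNS)

namespace PlanarSkeletonFrmQuasi

namespace NegB

open Neg

section ZonePx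

variable {κ : Consts} {V : Type} [DecidableEq V] [Countable V] {G : SimpleGraph V} [G.LocallyFinite] {Φ : PlanarSkeletonFrmQuasi G} {t : V} {p : unitInterval}
  {hC : Φ.CylSubcritical p} {gv fv : Neg.FSlot} {Pv : PSlot} {Sv : SSlot} {cv : CSlot} {bv : BSlot} {O : OutNS V} {q : unitInterval} {D : ℕ}

/-- The zone at ANY level is the fat seed: `Λ c k = fatSeq c k` (`FactsO.seed`). [folklore] -/
theorem zoneAt_eq_fatSeq {κ : Consts} {V : Type} [DecidableEq V] [Countable V] {G : SimpleGraph V} [G.LocallyFinite] {Φ : PlanarSkeletonFrmQuasi G} {t : V} {p : unitInterval} {hC : Φ.CylSubcritical p} {gv : Neg.FSlot} {fv : Neg.FSlot} {Pv : PSlot} {Sv : SSlot} {cv : CSlot} {bv : BSlot} {O : OutNS V} {q : unitInterval} (hAt : (choiceAtQ3 κ Φ t p Pv gv fv Sv cv bv hC).AtQNQ O q) (c : V) (k : ℕ) :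
    O.merged.Λ c k = Skelφ.fatSeq Φ.frame hC c k := by
  obtain ⟨-, -, -, -, hΛeq⟩ := Skelφ.StepI.OutO.FactsO.seed hAt.1.factsO
  exact congrFun (congrFun hΛeq c) k

/-- **`hczAt` under proxies**: the centre lies in its consumer-side zone `Λ (prox c) k` at every level `k ≥ D`. [this work] -/
theorem hczAt_of_atQPx {κ : Consts} {V : Type} [DecidableEq V] [Countable V] {G : SimpleGraph V} [G.LocallyFinite] {Φ : PlanarSkeletonFrmQuasi G} {t : V} {p : unitInterval} {hC : Φ.CylSubcritical p} {gv : Neg.FSlot} {fv : Neg.FSlot} {Pv : PSlot} {Sv : SSlot} {cv : CSlot} {bv : BSlot} {O : OutNS V} {q : unitInterval} {D : ℕ} (hAt : (choiceAtQ3 κ Φ t p Pv gv fv Sv cv bv hC).AtQNQ O q) (hP : Φ.HasProxies t D) (c : V) {k : ℕ} (hk : D ≤ k) :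
    c ∈ O.merged.Λ (hP.prox c) k := by
  rw [zoneAt_eq_fatSeq hAt (hP.prox c) k]
  exact hP.mem_fatSeq_prox hC c hk

/-- **`hcz` under proxies at `M_u`** (`D ≤ M_u`). [this work] -/
theorem hcz_of_atQPx {κ : Consts} {V : Type} [DecidableEq V] [Countable V] {G : SimpleGraph V} [G.LocallyFinite] {Φ : PlanarSkeletonFrmQuasi G} {t : V} {p : unitInterval} {hC : Φ.CylSubcritical p} {gv : Neg.FSlot} {fv : Neg.FSlot} {Pv : PSlot} {Sv : SSlot} {cv : CSlot} {bv : BSlot} {O : OutNS V} {q : unitInterval} {D : ℕ} (hAt : (choiceAtQ3 κ Φ t p Pv gv fv Sv cv bv hC).AtQNQ O q) (hP : Φ.HasProxies t D) (hD : D ≤ Mu O.merged) :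
    ∀ c, c ∈ O.merged.Λ (hP.prox c) (Mu O.merged) :=
  fun c => hczAt_of_atQPx hAt hP c hD

/-- **`hzconn` under proxies at every level `k ≥ D`**: the consumer-side zone is connected from the CENTRE inside itself. [this work] -/
theorem hzconnAt_of_atQPx {κ : Consts} {V : Type} [DecidableEq V] [Countable V] {G : SimpleGraph V} [G.LocallyFinite] {Φ : PlanarSkeletonFrmQuasi G} {t : V} {p : unitInterval} {hC : Φ.CylSubcritical p} {gv : Neg.FSlot} {fv : Neg.FSlot} {Pv : PSlot} {Sv : SSlot} {cv : CSlot} {bv : BSlot} {O : OutNS V} {q : unitInterval} {D : ℕ} (hAt : (choiceAtQ3 κ Φ t p Pv gv fv Sv cv bv hC).AtQNQ O q) (hP : Φ.HasProxies t D) {k : ℕ} (hk : D ≤ k) :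
    ∀ c, ∀ s ∈ O.merged.Λ (hP.prox c) k, PathIn G (↑(O.merged.Λ (hP.prox c) k) : Set V) c s := by
  intro c s hs
  have e := zoneAt_eq_fatSeq hAt (hP.prox c) k
  have eset : (↑(O.merged.Λ (hP.prox c) k) : Set V) = Skelφ.cylBall G Φ.φ (hP.prox c) k (Skelφ.fatRadius Φ.frame hC k) := by
    ext v; rw [Finset.mem_coe, e, Skelφ.mem_fatSeq_iff]
  rw [eset]
  have hs' : s ∈ Skelφ.cylBall G Φ.φ (hP.prox c) k (Skelφ.fatRadius Φ.frame hC k) := by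
    rw [e, Skelφ.mem_fatSeq_iff] at hs; exact hs
  have hc' : c ∈ Skelφ.cylBall G Φ.φ (hP.prox c) k (Skelφ.fatRadius Φ.frame hC k) := by
    have h := hczAt_of_atQPx hAt hP c hk
    rw [e, Skelφ.mem_fatSeq_iff] at h; exact h
  exact Skelφ.pathIn_cylBall' (G := G) (φ := Φ.φ) hc' hs'

/-- **`hzconn` under proxies at `M_u`** (`D ≤ M_u`). [this work] -/
theorem hzconn_of_atQPx {κ : Consts} {V : Type} [DecidableEq V] [Countable V] {G : SimpleGraph V} [G.LocallyFinite] {Φ : PlanarSkeletonFrmQuasi G} {t : V} {p : unitInterval} {hC : Φ.CylSubcritical p} {gv : Neg.FSlot} {fv : Neg.FSlot} {Pv : PSlot} {Sv : SSlot} {cv : CSlot} {bv : BSlot} {O : OutNS V} {q : unitInterval} {D : ℕ} (hAt : (choiceAtQ3 κ Φ t p Pv gv fv Sv cv bv hC).AtQNQ O q) (hP : Φ.HasProxies t D) (hD : D ≤ Mu O.merged) :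
    ∀ c, ∀ s ∈ O.merged.Λ (hP.prox c) (Mu O.merged), PathIn G (↑(O.merged.Λ (hP.prox c) (Mu O.merged)) : Set V) c s :=
  hzconnAt_of_atQPx hAt hP hD

-- GEN-Q (R-2, captain 2026-08-27): `PlanarSkeletonFrmFrom.NegB.hZρAt_of_atQPx` is not in the used cone of the node top — not ported.

-- GEN-Q (R-2, captain 2026-08-27): `PlanarSkeletonFrmFrom.NegB.hZρ_Rs_of_atQPx` is not in the used cone of the node top — not ported.

end ZonePx

end NegB

end PlanarSkeletonFrmQuasi

end Summit.CriticalPhenomena.PercolationContinuityZ3.Theorems.Transplant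

end
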